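import Literature.NumberTheory.Automorphic.ModularLambda
import Literature.NumberTheory.Automorphic.GammaTwoGenerators
import HarnessLib

/-!
# The modular `λ`-function is a modular function for `Γ(2)`

Sequel of `Literature/NumberTheory/Automorphic/ModularLambda.lean` (`modularLambda = θ₂⁴/θ₃⁴`,
with `λ(S • z) = 1 − λ(z)` and `λ(T² • z) = λ(z)` on `ℍ`) and of `GammaTwoGenerators.lean`
(`Γ(2) = ⟨T², S T² S⁻¹, −1⟩`): weight-`0` invariance of `λ` under every `γ ∈ Γ(2)` — the
statement that `λ` descends to the modular curve `Y(2) = ℍ/Γ(2)`, the base of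
Calegari–Dimitrov–Tang's argument (F. Calegari, V. Dimitrov, Y. Tang, J. Amer. Math. Soc. **38**
(2025), arXiv:2109.09040, §1 p. 3). Theorems only.
-/

noncomputable section

open Complex

namespace Literature.NumberTheory.Automorphic

namespace ModularLambda

open UpperHalfPlane ModularGroup CongruenceSubgroup Matrix.SpecialLinearGroup

open scoped MatrixGroups ModularForm

/-- **`λ` is a modular function for `Γ(2)`**: `λ|₀ γ = λ` for every `γ ∈ Γ(2)`, from the
invariance under the generators `T²`, `S T² S⁻¹`, `−1` (`GammaTwo.forall_mem_Gamma_two_slash_eq`).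
[cite: CalegariDimitrovTang2025, §1 p. 3] -/
theorem modularLambda_slash_eq {γ : SL(2, ℤ)} (hγ : γ ∈ CongruenceSubgroup.Gamma 2) :
    (fun z : ℍ ↦ modularLambda (z : ℂ)) ∣[(0 : ℤ)] γ =
      fun z : ℍ ↦ modularLambda (z : ℂ) := by
  have hS2 : (ModularGroup.S⁻¹ : SL(2, ℤ)) = -ModularGroup.S := ModularGroup.S_inv
  refine GammaTwo.forall_mem_Gamma_two_slash_eq (f := fun z : ℍ ↦ modularLambda (z : ℂ))
    (k := 0) ?_ ?_ ?_ γ hγ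
  · show (fun z : ℍ ↦ modularLambda (z : ℂ)) ∣[(0 : ℤ)] (ModularGroup.T ^ 2) =
        fun z : ℍ ↦ modularLambda (z : ℂ)
    ext z
    rw [ModularForm.SL_slash_apply, zpow_neg, zpow_zero, inv_one, mul_one,
      modularLambda_T_sq_smul]
  · show (fun z : ℍ ↦ modularLambda (z : ℂ)) ∣[(0 : ℤ)]
        (ModularGroup.S * ModularGroup.T ^ 2 * ModularGroup.S⁻¹) =
          fun z : ℍ ↦ modularLambda (z : ℂ)
    ext z
    rw [ModularForm.SL_slash_apply, zpow_neg, zpow_zero, inv_one, mul_one, mul_smul, mul_smul,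
      hS2, SL_neg_smul, modularLambda_S_smul, modularLambda_T_sq_smul, modularLambda_S_smul,
      sub_sub_cancel]
  · show (fun z : ℍ ↦ modularLambda (z : ℂ)) ∣[(0 : ℤ)] (-1 : SL(2, ℤ)) =
        fun z : ℍ ↦ modularLambda (z : ℂ)
    ext z
    rw [ModularForm.SL_slash_apply, zpow_neg, zpow_zero, inv_one, mul_one, SL_neg_smul, one_smul]

/-- **`λ(γ • z) = λ(z)`** for `γ ∈ Γ(2)`, `z ∈ ℍ`. [cite: CalegariDimitrovTang2025, §1 p. 3] -/
theorem modularLambda_smul {γ : SL(2, ℤ)} (hγ : γ ∈ CongruenceSubgroup.Gamma 2) (z : ℍ) :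
    modularLambda ((γ • z : ℍ) : ℂ) = modularLambda z := by
  have h := congr_fun (modularLambda_slash_eq hγ) z
  rwa [ModularForm.SL_slash_apply, zpow_neg, zpow_zero, inv_one, mul_one] at h

end ModularLambda

end Literature.NumberTheory.Automorphic

end
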